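import Summits.CriticalPhenomena.PercolationContinuityZ3.Theorems.PercNearOneGluingNoHeavyLowerTailFKHullPortDeltaNSBase
import Summits.CriticalPhenomena.PercolationContinuityZ3.Theorems.PercNearOneGluingNoHeavyLowerTailFKHullPortLemma2S
import HarnessLib

/-!
# FK sub-lane: `T^S ≥ 0` (owner set) for the random-cluster measure `φ_{𝐩,q}`, `q ≥ 1`, from (★^H) at singletons

Support file (`--supports stmt-CriticalPhenomena-4575`), FK sub-lane `prim-bschramm-fk-2` (gen 3); builds on p205010 (kernel theorem,
internal audit signed; external expert review pending).  No definitions, no named facts, no sorries; standard axioms.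

The owner-set copy of `…FKHullPortTAInduction.lean` (this cell): `FK.taQS_nonneg_of_starS : 0 ≤ taQS w q x S y z X g` — prim-hp-7's
`T^S ≥ 0` (HP7-HTW-PROOF; = (Htw), the (K9)-diagonal of PROOF-S5-ALL-R) for `φ_{𝐩,q}`, every `q ≥ 1`, every avoided set `X`
(weight-one pairs inside `X`), every marker, every monotone test function — modulo the hypothesis `hStarS` = hp-8's (★^H) at
singletons in `P_v` shape, discharged in `…FKHullPortTASHolds.lean` from `FK.starH_rc`.  bschramm/FK-Q2.md §12.6(c).
[cite: VandenbergHaggstromKahn2005, Thm. 2.1 (p. 9); §2.1 Lemma 2.3 (p. 10)] [cite: Gladkov2024, Thm. 3.2 (p. 4)]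
[cite: Grimmett2006, Thm. (3.1)(a), Thm. (3.8)(b), eq. (1.20)]
-/

noncomputable section

namespace Summit.CriticalPhenomena.PercolationContinuityZ3.Theorems.FK

open MeasureTheory Set Literature.Probability.LatticeModels Literature.Probability.Percolation
open Literature.Probability.Percolation.DecisionTree (ind ind_of_mem ind_of_not_mem ind_nonneg)
open Literature.Probability.Percolation.BHK2006 (rcMass delW)
open Summit.CriticalPhenomena.PercolationContinuityZ3.Theorems.HullPort (cut avoidEv connS)
open scoped Classical

variable {V : Type*} [Fintype V]

section TASInduction

open Literature.Probability.Percolation.BHK2006 (weight rcMass_nonneg coe_delW)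
open Summit.CriticalPhenomena.PercolationContinuityZ3.Theorems.HullPort (insert_mem_avoidEv_iff cut_insert_edge edge_mem_cut
  eq_of_reachable_of_isolated mem_cut_of_mem not_mem_of_reachable_of_noBoundary cut_eq_of_noBoundary
  bernstein_step bernstein_step_degenerate)

/-- If `y ∈ X` (`y ∉ S`) then `A^S = 0`. [folklore] -/
theorem taAS_eq_zero_of_mem (w : Sym2 V → unitInterval) (q : ℝ) (x : V) {S : Set V} {y : V} (z : V) (hyS : y ∉ S) (X : Set V)
    (hy : y ∈ X) (g : Set (Sym2 V) → ℝ) : taAS w q x S y z X g = 0 := by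
  unfold taAS
  refine Finset.sum_eq_zero fun ω _ => ?_
  rw [taCS_eq_zero_of_mem w q x hyS X hy g ω, mul_zero, mul_zero, mul_zero]

/-- If the owner `x` lies in the avoided set then `A^S = 0`. [folklore] -/
theorem taAS_eq_zero_of_root_mem (w : Sym2 V → unitInterval) (q : ℝ) (x : V) (S : Set V) (y z : V) (X : Set V) (hs : x ∈ X)
    (g : Set (Sym2 V) → ℝ) : taAS w q x S y z X g = 0 := by
  unfold taAS
  refine Finset.sum_eq_zero fun ω _ => ?_
  have : ω ∉ avoidEv x X := fun h => h x hs (SimpleGraph.Reachable.refl _)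
  rw [ind_of_not_mem this, zero_mul, mul_zero]

/-- If `y ∈ S ∪ X` then `a^S = 0`. [folklore] -/
theorem taaS_eq_zero_of_mem (w : Sym2 V → unitInterval) (q : ℝ) (S : Set V) (y z : V) (X : Set V) (hy : y ∈ S ∪ X) :
    taaS w q S y z X = 0 := by
  unfold taaS
  refine Finset.sum_eq_zero fun ω _ => ?_
  have : ω ∉ avoidEv y (S ∪ X) ∩ openConn y z := fun h => h.1 y hy (SimpleGraph.Reachable.refl _)
  rw [ind_of_not_mem this, mul_zero]

/-- **`T^S ≥ 0` for the random-cluster measure `φ_{𝐩,q}`, `q ≥ 1`, in the form `Q^S = A·b − a·B ≥ 0`, from (★^H) at singletons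
in `P_v` shape** (the owner-set copy of `FK.taQ_nonneg_of_Pv`; prim-hp-7 HP7-HTW-PROOF §4–§5 for `φ_{𝐩,q}`; bschramm/FK-Q2.md §12.6(c)):
for every weight vector whose weight-`1` pairs lie inside the avoided set `X`, every marker `z`, every monotone test function `g`.
Strong induction on `(|V ∖ X|, #fractional pairs touching X)`: base = rigid state (`FK.taQS_rigid_eq_zero`); step = one-edge Bernstein
deformation at a fractional pair touching `X` (`…FKHullPortTASSectionsS.lean`), closed by `HullPort.bernstein_step` with Lemma 2^S
(`FK.taaS_tabS_mono`) and Lemma `Δ_N^S` (`FK.deltaNS_nonneg_of_starS`).  `T^S ≥ 0` is (Htw) = the (K9)-diagonal of PROOF-S5-ALL-R for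
`φ_{𝐩,q}`, modulo `hStarS`.
[cite: VandenbergHaggstromKahn2005, Thm. 2.1 (p. 9); §2.1 Lemma 2.3 (p. 10)] [cite: Gladkov2024, Thm. 3.2 (p. 4)]
[cite: Grimmett2006, Thm. (3.1)(a), Thm. (3.8)(b), eq. (1.20)] -/
theorem taQS_nonneg_of_starS {q : ℝ} (hq : 1 ≤ q) (x : V) (S : Set V) (y : V) (hyS : y ∉ S) (g : Set (Sym2 V) → ℝ)
    (hg : Monotone g)
    (hStarS : ∀ (u : Sym2 V → unitInterval) (v' : V),
      taBS u q x S y {v'} g ≤ rcPartitionFunctionW u q ∅ *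
        ((1 - wE u q ∅ (ind ((connS S y : Set (Set (Sym2 V)))ᶜ ∩ openConn y v')) /
              wE u q ∅ (ind (connS S y : Set (Set (Sym2 V)))ᶜ)) *
          (wE u q ∅ (fun η => g (openEdgeCluster η x) * ind (connS S y) η) -
            wE u q ∅ (fun η => g (openEdgeCluster η x)) * wE u q ∅ (ind (connS S y)))))
    (w : Sym2 V → unitInterval) (X : Set V) (hINV : ∀ p : Sym2 V, ((w p : unitInterval) : ℝ) = 1 → ∀ u ∈ p, u ∈ X) (z : V) :
    0 ≤ taQS w q x S y z X g := by
  classical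
  have hq0 : 0 < q := one_pos.trans_le hq
  set M : ℕ := Fintype.card (Sym2 V) with hM
  set cV : Set V → ℕ := fun X => (Finset.univ.filter (fun u : V => u ∉ X)).card with hcV
  set cF : (Sym2 V → unitInterval) → Set V → ℕ := fun w X =>
    (Finset.univ.filter (fun p : Sym2 V => ¬ p.IsDiag ∧ (∃ c ∈ p, c ∈ X) ∧
      0 < ((w p : unitInterval) : ℝ) ∧ ((w p : unitInterval) : ℝ) < 1)).card with hcF
  have main : ∀ (N : ℕ) (w : Sym2 V → unitInterval) (X : Set V),
      (∀ p : Sym2 V, ((w p : unitInterval) : ℝ) = 1 → ∀ u ∈ p, u ∈ X) → cV X * (M + 1) + cF w X = N →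
      ∀ z : V, 0 ≤ taQS w q x S y z X g := by
    intro N
    induction N using Nat.strong_induction_on with
    | _ N ih =>
    intro w X hINV hN z
    -- general facts about the measure (as in `FK.deltaN_nonneg_of_single`)
    have hFle : ∀ (w' : Sym2 V → unitInterval) (X' : Set V), cF w' X' ≤ M := by
      intro w' X'
      simp only [hcF]
      exact (Finset.card_le_card (Finset.filter_subset _ _)).trans (by rw [Finset.card_univ])
    have hFlt : ∀ (w' : Sym2 V → unitInterval) (X' : Set V) (p₀ : Sym2 V), (∀ p, p ≠ p₀ → w' p = w p) →
        (((w' p₀ : unitInterval) : ℝ) = 0 ∨ ((w' p₀ : unitInterval) : ℝ) = 1) →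
        (¬ p₀.IsDiag ∧ (∃ c ∈ p₀, c ∈ X) ∧ 0 < ((w p₀ : unitInterval) : ℝ) ∧ ((w p₀ : unitInterval) : ℝ) < 1) →
        (∀ u, u ∈ X' ↔ u ∈ X) → cF w' X' < cF w X := by
      intro w' X' p₀ hoff h01 hp₀ hXX
      simp only [hcF]
      apply Finset.card_lt_card
      rw [Finset.ssubset_iff_of_subset]
      · refine ⟨p₀, Finset.mem_filter.2 ⟨Finset.mem_univ _, hp₀⟩, fun h => ?_⟩
        have h' := (Finset.mem_filter.1 h).2
        rcases h01 with h01 | h01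
        · linarith [h'.2.2.1]
        · linarith [h'.2.2.2]
      · intro p hp
        have h' := (Finset.mem_filter.1 hp).2
        by_cases hpp : p = p₀
        · subst hpp
          rcases h01 with h01 | h01
          · linarith [h'.2.2.1]
          · linarith [h'.2.2.2]
        · rw [hoff p hpp] at h'
          obtain ⟨h1', ⟨c', hc'p, hc'X⟩, h3', h4'⟩ := h'
          exact Finset.mem_filter.2 ⟨Finset.mem_univ _, h1', ⟨c', hc'p, (hXX c').1 hc'X⟩, h3', h4'⟩
    have hcVle : ∀ X₁ X₂ : Set V, X₁ ⊆ X₂ → cV X₂ ≤ cV X₁ := by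
      intro X₁ X₂ h12
      simp only [hcV]
      apply Finset.card_le_card
      intro u hu
      exact Finset.mem_filter.2 ⟨Finset.mem_univ _, fun h => (Finset.mem_filter.1 hu).2 (h12 h)⟩
    have hcVlt : ∀ (X₁ X₂ : Set V) (d : V), X₁ ⊆ X₂ → d ∈ X₂ → d ∉ X₁ → cV X₂ < cV X₁ := by
      intro X₁ X₂ d h12 hd2 hd1
      simp only [hcV]
      apply Finset.card_lt_card
      rw [Finset.ssubset_iff_of_subset]
      · exact ⟨d, Finset.mem_filter.2 ⟨Finset.mem_univ _, hd1⟩, fun h => (Finset.mem_filter.1 h).2 hd2⟩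
      · intro u hu
        exact Finset.mem_filter.2 ⟨Finset.mem_univ _, fun h => (Finset.mem_filter.1 hu).2 (h12 h)⟩
    have hdec0 : ∀ (p₀ : Sym2 V), (¬ p₀.IsDiag ∧ (∃ c ∈ p₀, c ∈ X) ∧ 0 < ((w p₀ : unitInterval) : ℝ) ∧
        ((w p₀ : unitInterval) : ℝ) < 1) → cV X * (M + 1) + cF (Function.update w p₀ 0) X < N := by
      intro p₀ hp₀
      rw [← hN]
      have := hFlt (Function.update w p₀ 0) X p₀ (fun p hp => Function.update_of_ne hp _ _) (Or.inl (by simp)) hp₀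
        (fun u => Iff.rfl)
      omega
    have hdec1 : ∀ (p₀ : Sym2 V) (d : V), d ∈ p₀ → (¬ p₀.IsDiag ∧ (∃ c ∈ p₀, c ∈ X) ∧ 0 < ((w p₀ : unitInterval) : ℝ) ∧
        ((w p₀ : unitInterval) : ℝ) < 1) → cV (insert d X) * (M + 1) + cF (Function.update w p₀ 1) (insert d X) < N := by
      intro p₀ d hdp hp₀
      rw [← hN]
      by_cases hdX : d ∈ X
      · have hXX : ∀ u, u ∈ insert d X ↔ u ∈ X := fun u =>
          ⟨fun h => h.elim (fun h' => h' ▸ hdX) id, fun h => Set.mem_insert_of_mem _ h⟩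
        have h1' := hFlt (Function.update w p₀ 1) (insert d X) p₀ (fun p hp => Function.update_of_ne hp _ _)
          (Or.inr (by simp)) hp₀ hXX
        have h2' := hcVle X (insert d X) (Set.subset_insert _ _)
        have h3 := Nat.mul_le_mul_right (M + 1) h2'
        omega
      · have h1' := hcVlt X (insert d X) d (Set.subset_insert _ _) (Set.mem_insert _ _) hdX
        have h2' := hFle (Function.update w p₀ 1) (insert d X)
        have h3 := Nat.mul_le_mul_right (M + 1) (Nat.succ_le_of_lt h1')
        rw [Nat.succ_mul] at h3
        omega
    have IH : ∀ (w' : Sym2 V → unitInterval) (X' : Set V),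
        (∀ p : Sym2 V, ((w' p : unitInterval) : ℝ) = 1 → ∀ u ∈ p, u ∈ X') → cV X' * (M + 1) + cF w' X' < N →
        ∀ z' : V, 0 ≤ taQS w' q x S y z' X' g :=
      fun w' X' hINV' hlt z' => ih _ hlt w' X' hINV' rfl z'
    -- trivial cases
    by_cases hsX : x ∈ X
    · unfold taQS
      rw [taAS_eq_zero_of_root_mem w q x S y z X hsX g, taBS_eq_zero_of_root_mem w q x S y X hsX g]
      simp
    by_cases hyX : y ∈ X
    · unfold taQS
      rw [taAS_eq_zero_of_mem w q x z hyS X hyX g, taBS_eq_zero_of_mem w q x hyS X hyX g]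
      simp
    -- the fractional pairs touching `X`
    set F : Finset (Sym2 V) := Finset.univ.filter (fun p : Sym2 V => ¬ p.IsDiag ∧ (∃ c ∈ p, c ∈ X) ∧
      0 < ((w p : unitInterval) : ℝ) ∧ ((w p : unitInterval) : ℝ) < 1) with hF
    by_cases hF0 : F = ∅
    · -- BASE: rigid state
      have hR : ∀ p : Sym2 V, ¬ p.IsDiag → (∃ u ∈ p, u ∈ X) →
          ((w p : unitInterval) : ℝ) = 0 ∨ ((w p : unitInterval) : ℝ) = 1 := by
        intro p hpd hpc
        by_contra hcon
        have hw0 : 0 ≤ ((w p : unitInterval) : ℝ) := (w p).2.1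
        have hw1 : ((w p : unitInterval) : ℝ) ≤ 1 := (w p).2.2
        have hne0 : ((w p : unitInterval) : ℝ) ≠ 0 := fun h => hcon (Or.inl h)
        have hne1 : ((w p : unitInterval) : ℝ) ≠ 1 := fun h => hcon (Or.inr h)
        have : p ∈ F := by
          rw [hF, Finset.mem_filter]
          exact ⟨Finset.mem_univ _, hpd, hpc, lt_of_le_of_ne hw0 (Ne.symm hne0), lt_of_le_of_ne hw1 hne1⟩
        rw [hF0] at this
        exact absurd this (Finset.notMem_empty _)
      exact le_of_eq (taQS_rigid_eq_zero w hq0 z hyS hsX hyX hR hINV g).symm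
    · -- STEP: deform a fractional pair `e = s(a,b)` touching `X`
      obtain ⟨e, heF⟩ := Finset.nonempty_iff_ne_empty.2 hF0
      obtain ⟨hed, ⟨a, hae, haX⟩, he0, he1⟩ := (Finset.mem_filter.1 heF).2
      set b : V := Sym2.Mem.other hae with hb
      have heab : e = s(a, b) := (Sym2.other_spec hae).symm
      have hab : a ≠ b := fun h => Sym2.other_ne hed hae h.symm
      have hfrac_e : ¬ e.IsDiag ∧ (∃ c ∈ e, c ∈ X) ∧ 0 < ((w e : unitInterval) : ℝ) ∧ ((w e : unitInterval) : ℝ) < 1 :=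
        ⟨hed, ⟨a, hae, haX⟩, he0, he1⟩
      set t : ℝ := ((w e : unitInterval) : ℝ) with ht
      -- corner quantities at `(w[e↦0], X)` and `(w[e↦1], X ∪ {b})`
      set A₀ := taAS (Function.update w e 0) q x S y z X g with hA₀
      set A₁ := taAS (Function.update w e 1) q x S y z (insert b X) g with hA₁
      set B₀ := taBS (Function.update w e 0) q x S y X g with hB₀
      set B₁ := taBS (Function.update w e 1) q x S y (insert b X) g with hB₁
      set a₀ := taaS (Function.update w e 0) q S y z X with ha₀
      set a₁ := taaS (Function.update w e 1) q S y z (insert b X) with ha₁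
      set b₀ := tabS (Function.update w e 0) q S y X with hb₀
      set b₁ := tabS (Function.update w e 1) q S y (insert b X) with hb₁
      have sA : taAS w q x S y z X g = (1 - t) * A₀ + t * A₁ := by
        have h := taAS_sectionFK w q x S y z a b X haX g; rw [← heab] at h; exact h
      have sB : taBS w q x S y X g = (1 - t) * B₀ + t * B₁ := by
        have h := taBS_sectionFK w q x S y a b X haX g; rw [← heab] at h; exact h
      have sa : taaS w q S y z X = (1 - t) * a₀ + t * a₁ := by
        have h := taaS_sectionFK w q S y z a b X haX; rw [← heab] at h; exact h
      have sb : tabS w q S y X = (1 - t) * b₀ + t * b₁ := by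
        have h := tabS_sectionFK w q S y a b X haX; rw [← heab] at h; exact h
      unfold taQS
      rw [sA, sB, sa, sb]
      have ht0 : 0 ≤ t := he0.le
      have ht1 : t ≤ 1 := he1.le
      -- INV for the corner states
      have hINVe0 : ∀ p : Sym2 V, ((Function.update w e 0 p : unitInterval) : ℝ) = 1 → ∀ u ∈ p, u ∈ X := by
        intro p hp u hu
        by_cases hpe : p = e
        · subst hpe; simp at hp
        · rw [Function.update_of_ne hpe] at hp; exact hINV p hp u hu
      have hINVe1 : ∀ p : Sym2 V, ((Function.update w e 1 p : unitInterval) : ℝ) = 1 → ∀ u ∈ p, u ∈ insert b X := by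
        intro p hp u hu
        by_cases hpe : p = e
        · subst hpe
          rw [heab] at hu
          rcases Sym2.mem_iff.1 hu with rfl | rfl
          · exact Set.mem_insert_of_mem _ haX
          · exact Set.mem_insert _ _
        · rw [Function.update_of_ne hpe] at hp; exact Set.mem_insert_of_mem _ (hINV p hp u hu)
      -- the two smaller states
      have hQ0 : 0 ≤ A₀ * b₀ - a₀ * B₀ := by
        have h := IH (Function.update w e 0) X hINVe0 (hdec0 e hfrac_e) z
        unfold taQS at h
        rw [hA₀, hb₀, ha₀, hB₀]; exact h
      have hQ1 : 0 ≤ A₁ * b₁ - a₁ * B₁ := by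
        have h := IH (Function.update w e 1) (insert b X) hINVe1 (hdec1 e b (by rw [heab]; exact Sym2.mem_mk_right _ _) hfrac_e) z
        unfold taQS at h
        rw [hA₁, hb₁, ha₁, hB₁]; exact h
      -- Lemma Δ_N and Lemma 2
      have hΔ : 0 ≤ B₀ * b₁ - B₁ * b₀ := by
        have h := deltaNS_nonneg_of_starS hq x S y hyS g hg hStarS w X hINV haX hab (by rw [← heab]; exact he0)
          (by rw [← heab]; exact he1)
        rw [← heab] at h
        rw [hB₀, hb₁, hB₁, hb₀]; exact h
      have hL : 0 ≤ a₀ * b₁ - a₁ * b₀ := by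
        have h := taaS_tabS_mono w hq S y z X haX hab (by rw [← heab]; exact he0) (by rw [← heab]; exact he1)
        rw [← heab] at h
        rw [ha₀, hb₁, ha₁, hb₀]; linarith [h]
      by_cases hby : b = y
      · -- degenerate endpoint: the contracted state absorbs `y`
        have hA₁0 : A₁ = 0 := by rw [hA₁, hby]; exact taAS_eq_zero_of_mem _ q x z hyS _ (Set.mem_insert _ _) g
        have hB₁0 : B₁ = 0 := by rw [hB₁, hby]; exact taBS_eq_zero_of_mem _ q x hyS _ (Set.mem_insert _ _) g
        have ha₁0 : a₁ = 0 := by rw [ha₁, hby]; exact taaS_eq_zero_of_mem _ q S y z _ (Set.mem_union_right _ (Set.mem_insert _ _))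
        have hb₁0 : b₁ = 0 := by rw [hb₁, hby]; exact tabS_eq_zero_of_mem _ q S y _ (Set.mem_union_right _ (Set.mem_insert _ _))
        exact bernstein_step_degenerate A₀ A₁ B₀ B₁ a₀ a₁ b₀ b₁ t hQ0 hA₁0 hB₁0 ha₁0 hb₁0
      · have hySX : y ∉ S ∪ X := by
          rintro (h | h)
          · exact hyS h
          · exact hyX h
        have hybX : y ∉ S ∪ insert b X := by
          rintro (h | h | h)
          · exact hyS h
          · exact hby h.symm
          · exact hyX h
        have hb₀pos : 0 < b₀ := tabS_pos _ hq0 S X hINVe0 hySX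
        have hb₁pos : 0 < b₁ := tabS_pos _ hq0 S (insert b X) hINVe1 hybX
        exact bernstein_step A₀ A₁ B₀ B₁ a₀ a₁ b₀ b₁ t ht0 ht1 hQ0 hQ1 hΔ hL hb₀pos hb₁pos
  exact main _ w X hINV rfl z

end TASInduction

end Summit.CriticalPhenomena.PercolationContinuityZ3.Theorems.FK

end
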